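import Summits.Ventures.DiscreteObjects.Hadamard.ConferenceRoute668
import Summits.Ventures.DiscreteObjects.Hadamard.PaleyConference

/-!
# Paley's Hadamard matrices of order `2(p + 1)` for every odd prime `p`, in the kernel (doubling of the Paley conference matrix)

Framing: lottery ticket; floor = certified bounds/negative ranges.  Cell pub-namedobj (venture DiscreteObjects), target (H),
hadamard gen 27.  Composition of `paley_conference` (Paley's `C(p + 1)`, any odd prime `p`) with `conference_double_isHadamard`
(the doubling `[[C + I, C − I], [Cᵀ − I, −Cᵀ − I]]` is Hadamard for ANY conference matrix): **`paley_hadamard_double`** — a Hadamard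
matrix of order `2(p + 1)` for every odd prime `p` (for `p ≡ 1 (mod 4)` this is Paley's second family; for `p ≡ 3 (mod 4)` it is
the double of the skew-type Paley matrix).  An infinite family of `(+)` controls for the row-F11 pipeline `C(m) ⇒ H(2m)` of the
`H(668)` census (at `m = 334`, `333 = 3²·37` is not a prime and the circulant-core sub-family is EMPTY, gen 27).  PRINT STATUS:
Paley 1933; formalisation ours.  No `sorry`.
-/

namespace Summit.Ventures.DiscreteObjects.Hadamard

open Finset BigOperators Matrix

open Literature.Combinatorics.Designs.GoethalsSeidel (IsHadamardMatrix)

variable {p : ℕ} [hp : Fact p.Prime]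

/-- **Paley–Hadamard matrices of order `2(p + 1)`** (`p` an odd prime): the doubling of Paley's conference matrix. -/
theorem paley_hadamard_double (hp2 : p ≠ 2) :
    ∃ H : Matrix (Option (ZMod p) ⊕ Option (ZMod p)) (Option (ZMod p) ⊕ Option (ZMod p)) ℤ,
      IsHadamardMatrix H ∧ Fintype.card (Option (ZMod p) ⊕ Option (ZMod p)) = 2 * (p + 1) := by
  obtain ⟨h1, h2, h3, h4⟩ := paley_conference (p := p) hp2
  exact ⟨_, conference_double_isHadamard _ h1 h2 h3, by rw [Fintype.card_sum, h4]; ring⟩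

/-- the smallest instances as named controls: `p = 5` gives `H(12)`, `p = 13` gives `H(28)`, `p = 17` gives `H(36)`. -/
theorem paley_hadamard_double_thirteen :
    ∃ H : Matrix (Option (ZMod 13) ⊕ Option (ZMod 13)) (Option (ZMod 13) ⊕ Option (ZMod 13)) ℤ,
      IsHadamardMatrix H ∧ Fintype.card (Option (ZMod 13) ⊕ Option (ZMod 13)) = 28 :=
  haveI : Fact (Nat.Prime 13) := ⟨by norm_num⟩
  paley_hadamard_double (p := 13) (by norm_num)

end Summit.Ventures.DiscreteObjects.Hadamard
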